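import Literature.MathematicalPhysics.QuantumFieldTheory.TorusFreeTransfer
import Mathlib.MeasureTheory.Measure.Tilted
import HarnessLib

/-!
# `ColdBoxSourcedPressure` (KS1′, stmt-QuantumFields-23996) / `SourcedPressureDecoupling` (KS2′, stmt-QuantumFields-24028), helper:
# the torus state tilted by the OUTSIDE action is the free-boundary theory of the cell

Route `SourcedPressureJensen` (rev 7) writes every free-cell quantity INSIDE an ambient torus: the free-boundary Wilson state of
the cell `Λ ⊂ ℤ^d` is the torus state `μ_T` of side `L` tilted by `+β·S_out`, `S_out` = the Wilson cost of the plaquettes NOT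
inside the cell, i.e. `E_T[F · e^{βS_out}] / E_T[e^{βS_out}]`.  This file proves the BRIDGE to the tree's free-boundary lattice
gauge theory of Sweep1 (`zdWilsonMeasure ρ β Λ`, `zdExpect ρ β Λ`, on which Chatterjee's free-cube machinery is built):

* **`integral_comp_torusLift_tilted_eq_zdExpect`** — if `βS_out − βS_T = −β S_Λ ∘ torusLift` (the tilt removes exactly the outside
  plaquettes) and the periodisation `torusEdge L` is injective on the bonds of the plaquettes of `Λ`, then for every measurable `F`
  depending only on those bonds, `∫ F ∘ torusLift L d(μ_T.tilted (β·S_out)) = zdExpect ρ β Λ F` — in particular the value does not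
  depend on the ambient torus;
* `wilsonExpectation_mul_exp_div_eq_zdExpect` — the same in the route's ratio form
  `E_T[(F ∘ torusLift) · e^{βS_out}] / E_T[e^{βS_out}] = zdExpect ρ β Λ F`;
* the abstract ratio/tilt identity `wilsonExpectation_mul_exp_div_eq_integral_tilted`.

Mechanism: Mathlib's `integral_tilted`; torus and free-boundary expectations as ratios of Haar integrals
(`wilsonExpectation_eq_div_integral`, `zdExpect_eq_div_integral`); the tree's transfer lemma `integral_torusLift_eq_integral_zdHaar`
(marginal of the finite product Haar measure along the injective periodisation = marginal of `dg_∞`).  The route-specific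
identification of `S_out` for the cell `[0,ℓ]⁴` (a reindexing of the torus plaquette sum) is NOT done here.  Literature-only
imports; no definition, no named fact.  RECORD-label rung support; the Yang–Mills mass gap is NOT proved by anything here. [folklore]
-/

noncomputable section

open MeasureTheory Finset
open Literature.Probability.LatticeModels Literature.MathematicalPhysics.QuantumLattice
open Literature.MathematicalPhysics.QuantumFieldTheory Literature.MathematicalPhysics.QuantumFieldTheory.AreaLaw

namespace Summit.QuantumFields.YangMills.Theorems.SourcedPressureJensen

variable {d N : ℕ} {G : Type*} [Group G] [TopologicalSpace G] [IsTopologicalGroup G] [CompactSpace G]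
  [MeasurableSpace G] [BorelSpace G]

/-- Composition preserves coordinate dependence: if `F` depends only on the coordinates in `S`, so does `g ∘ F`. [folklore] -/
theorem dependsOn_comp {ι α β γ : Type*} {F : (ι → α) → β} {S : Set ι} (hF : DependsOn F S) (g : β → γ) :
    DependsOn (fun U => g (F U)) S :=
  fun _ _ h => congrArg g (hF h)

/-- **Ratio form = tilted integral.**  For the torus Wilson state `μ_T` and any real `W`, `F`:
`E_T[F · e^{W}] / E_T[e^{W}] = ∫ F d(μ_T.tilted W)` (Mathlib `integral_tilted`). [folklore] -/
theorem wilsonExpectation_mul_exp_div_eq_integral_tilted (ρ : G →* Matrix (Fin N) (Fin N) ℂ) (β : ℝ) {L : ℕ} [NeZero L]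
    (W F : GaugeConfig d L G → ℝ) :
    wilsonExpectation ρ β (fun U => F U * Real.exp (W U)) / wilsonExpectation ρ β (fun U => Real.exp (W U)) =
      ∫ U, F U ∂((wilsonMeasure (d := d) (L := L) ρ β).tilted W) := by
  unfold wilsonExpectation
  rw [integral_tilted]
  simp only [smul_eq_mul]
  rw [← integral_div]
  refine integral_congr_ae (ae_of_all _ fun U => ?_)
  simp only
  ring

/-- **The bridge.**  Let `Λ ⊂ ℤ^d` be finite, `S_out : G^{E(torus)} → ℝ` with `β·S_out − β·S_T = −β·S_Λ ∘ torusLift L` (the tilt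
by `+βS_out` removes exactly the plaquettes outside the embedded cell), and let the periodisation `torusEdge L` be injective on the
bonds of the plaquettes of `Λ`.  Then for every measurable `F : G^{E(ℤ^d)} → ℝ` depending only on those bonds,
`∫ F (torusLift L U) d(μ_T.tilted (β·S_out))(U) = zdExpect ρ β Λ F` — the free-boundary expectation of Sweep1; in particular the
left side does not depend on the ambient torus. [folklore] -/
theorem integral_comp_torusLift_tilted_eq_zdExpect [SecondCountableTopology G] (ρ : G →* Matrix (Fin N) (Fin N) ℂ)
    (hρ : Continuous ρ) (β : ℝ) {L : ℕ} [NeZero L] (Λ : Finset (Literature.Probability.LatticeModels.Site d))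
    (Sout : GaugeConfig d L G → ℝ)
    (hS : ∀ U : GaugeConfig d L G, β * Sout U + -β * wilsonAction ρ U = -β * zdWilsonAction ρ Λ (torusLift L U))
    (hinj : Set.InjOn (torusEdge (d := d) L) (((plaquettesIn Λ).biUnion Plaq.bonds : Finset (Literature.MathematicalPhysics.QuantumLattice.ZdEdge d)) : Set (Literature.MathematicalPhysics.QuantumLattice.ZdEdge d)))
    {F : ZdGaugeConfig d G → ℝ} (hFm : Measurable F)
    (hdep : DependsOn F (((plaquettesIn Λ).biUnion Plaq.bonds : Finset (Literature.MathematicalPhysics.QuantumLattice.ZdEdge d)) : Set (Literature.MathematicalPhysics.QuantumLattice.ZdEdge d))) :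
    ∫ U, F (torusLift L U) ∂((wilsonMeasure (d := d) (L := L) ρ β).tilted (fun U => β * Sout U)) = zdExpect ρ β Λ F := by
  set π : Measure (GaugeConfig d L G) := Measure.pi fun _ : Edge d L => haarProbability G with hπ
  haveI : IsProbabilityMeasure π := by rw [hπ]; infer_instance
  -- Step 1: tilted integral = ratio of torus expectations = ratio of Haar integrals
  rw [← wilsonExpectation_mul_exp_div_eq_integral_tilted ρ β (fun U => β * Sout U) (fun U => F (torusLift L U)),
    wilsonExpectation_eq_div_integral ρ hρ β, wilsonExpectation_eq_div_integral ρ hρ β]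
  -- the common denominator `∫ e^{-βS} dπ` is positive
  have hZ : (∫ U, Real.exp (-β * wilsonAction ρ U) ∂π) ≠ 0 := by
    refine (integral_exp_pos ?_).ne'
    exact (Real.continuous_exp.comp (continuous_const.mul (continuous_wilsonAction ρ hρ))).integrable_of_hasCompactSupport
      (HasCompactSupport.of_compactSpace _)
  rw [div_div_div_cancel_right₀ hZ]
  -- Step 2: combine the tilt with the Wilson weight: `e^{βS_out} e^{-βS} = e^{-βS_Λ ∘ torusLift}`
  have hcomb : ∀ U : GaugeConfig d L G,
      Real.exp (β * Sout U) * Real.exp (-β * wilsonAction ρ U) = Real.exp (-β * zdWilsonAction ρ Λ (torusLift L U)) := by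
    intro U
    rw [← Real.exp_add, hS U]
  have hnum : (∫ U, F (torusLift L U) * Real.exp (β * Sout U) * Real.exp (-β * wilsonAction ρ U) ∂π) =
      ∫ U, (fun V : ZdGaugeConfig d G => F V * Real.exp (-β * zdWilsonAction ρ Λ V)) (torusLift L U) ∂π := by
    refine integral_congr_ae (ae_of_all _ fun U => ?_)
    simp only
    rw [mul_assoc, hcomb U]
  have hden : (∫ U, Real.exp (β * Sout U) * Real.exp (-β * wilsonAction ρ U) ∂π) =
      ∫ U, (fun V : ZdGaugeConfig d G => Real.exp (-β * zdWilsonAction ρ Λ V)) (torusLift L U) ∂π :=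
    integral_congr_ae (ae_of_all _ fun U => hcomb U)
  rw [hnum, hden]
  -- Step 3: transfer both Haar integrals to `dg_∞`
  have hSm : Measurable (zdWilsonAction (d := d) ρ Λ) := (continuous_zdWilsonAction ρ hρ Λ).measurable
  have hEm : Measurable fun V : ZdGaugeConfig d G => Real.exp (-β * zdWilsonAction ρ Λ V) :=
    Real.measurable_exp.comp (hSm.const_mul _)
  have hEdep : DependsOn (fun V : ZdGaugeConfig d G => Real.exp (-β * zdWilsonAction ρ Λ V))
      (((plaquettesIn Λ).biUnion Plaq.bonds : Finset (Literature.MathematicalPhysics.QuantumLattice.ZdEdge d)) : Set (Literature.MathematicalPhysics.QuantumLattice.ZdEdge d)) :=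
    dependsOn_comp (dependsOn_zdWilsonAction ρ Λ) fun s => Real.exp (-β * s)
  have hPdep : DependsOn (fun V : ZdGaugeConfig d G => F V * Real.exp (-β * zdWilsonAction ρ Λ V))
      (((plaquettesIn Λ).biUnion Plaq.bonds : Finset (Literature.MathematicalPhysics.QuantumLattice.ZdEdge d)) : Set (Literature.MathematicalPhysics.QuantumLattice.ZdEdge d)) := by
    have h := dependsOn_mul hdep hEdep
    rwa [Set.union_self] at h
  have hPm : Measurable fun V : ZdGaugeConfig d G => F V * Real.exp (-β * zdWilsonAction ρ Λ V) := hFm.mul hEm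
  rw [hπ, integral_torusLift_eq_integral_zdHaar hinj hPm hPdep, integral_torusLift_eq_integral_zdHaar hinj hEm hEdep,
    zdExpect_eq_div_integral ρ hρ β Λ F]

/-- **The bridge, ratio form** (the shape in which the route's rev-7 statements are written):
`E_T[(F ∘ torusLift L) · e^{βS_out}] / E_T[e^{βS_out}] = zdExpect ρ β Λ F` under the same hypotheses. [folklore] -/
theorem wilsonExpectation_mul_exp_div_eq_zdExpect [SecondCountableTopology G] (ρ : G →* Matrix (Fin N) (Fin N) ℂ)
    (hρ : Continuous ρ) (β : ℝ) {L : ℕ} [NeZero L] (Λ : Finset (Literature.Probability.LatticeModels.Site d))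
    (Sout : GaugeConfig d L G → ℝ)
    (hS : ∀ U : GaugeConfig d L G, β * Sout U + -β * wilsonAction ρ U = -β * zdWilsonAction ρ Λ (torusLift L U))
    (hinj : Set.InjOn (torusEdge (d := d) L) (((plaquettesIn Λ).biUnion Plaq.bonds : Finset (Literature.MathematicalPhysics.QuantumLattice.ZdEdge d)) : Set (Literature.MathematicalPhysics.QuantumLattice.ZdEdge d)))
    {F : ZdGaugeConfig d G → ℝ} (hFm : Measurable F)
    (hdep : DependsOn F (((plaquettesIn Λ).biUnion Plaq.bonds : Finset (Literature.MathematicalPhysics.QuantumLattice.ZdEdge d)) : Set (Literature.MathematicalPhysics.QuantumLattice.ZdEdge d))) :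
    wilsonExpectation ρ β (fun U => F (torusLift L U) * Real.exp (β * Sout U)) /
        wilsonExpectation ρ β (fun U => Real.exp (β * Sout U)) = zdExpect ρ β Λ F := by
  rw [wilsonExpectation_mul_exp_div_eq_integral_tilted]
  exact integral_comp_torusLift_tilted_eq_zdExpect ρ hρ β Λ Sout hS hinj hFm hdep

end Summit.QuantumFields.YangMills.Theorems.SourcedPressureJensen
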